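import Literature.NumberTheory.Transcendental.MZVSimplexRepFubini
import Literature.NumberTheory.Transcendental.MultipleZetaProofs
import HarnessLib

/-!
# Kontsevich's formula: the simplex representation computes the multiple zeta value

Discharge of the named fact `Literature.NumberTheory.Transcendental.KZ.mzvRep_value`
(`MZVSimplexRep.lean`): for every admissible index `s`,
`(KZ.mzvRep s …).value = ∫_{1 > t₁ > ⋯ > t_w > 0} ∏ᵢ ω_{εᵢ}(tᵢ) dt = ζ(s₁, …, s_k)`
[Kontsevich–Zagier 2001, §1.1; Zagier 1994, §9; Brown 2012, eq. (1.2)].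

## Proof

The classical one (Zagier 1994, §9): by induction along the binary word
`ε(s) = 0^{s₁-1} 1 ⋯ 0^{s_k-1} 1`, the iterated integral with variable upper bound `x ∈ (0, 1]` is
the multiple polylogarithm,
`Λ_{ε(s)}(x) = ∑_{n₁ > ⋯ > n_k ≥ 1} x^{n₁} / (n₁^{s₁} ⋯ n_k^{s_k})`
(`KZ.MZVSimplex.wordLIntegral_binaryWord`); the letter `0` divides the coefficient of `x^{n₁}` by
`n₁` (`KZ.MZVSimplex.wordLIntegral_false_cons`), the letter `1` multiplies by the geometric series
and integrates, prepending a new largest summation index (`KZ.MZVSimplex.wordLIntegral_true_cons`,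
with the bijection `(n, m) ↦ (n₁ + m + 1) :: n` of summation domains). Everything is computed with
lower Lebesgue integrals in `ℝ≥0∞` (Tonelli, monotone convergence: file
`MZVSimplexRepFubini.lean`), so no convergence hypothesis is ever needed; at `x = 1` one passes to
real numbers with `ENNReal.tsum_toReal_eq`, the junk-value conventions of `∫` and `∑'` agreeing.
In particular the hypotheses `h₁ h₂` of `mzvRep` are not used beyond measurability.

## Contents

* `mzvTerm_nil`, `mzvTerm_one_cons`, `mzvTerm_succ_cons`, `cons_mem_mzvIndexSet_iff` — the summand
  and summation domain of `multipleZeta` under `Fin.cons` (`mzvTerm_nonneg` is in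
  `MultipleZetaProofs.lean`);
* `KZ.MZVSimplex.wordLIntegral_true_cons`, `KZ.MZVSimplex.wordLIntegral_false_cons`,
  `KZ.MZVSimplex.wordLIntegral_binaryWord` — the induction;
* `KZ.mzvRep_value_holds : KZ.mzvRep_value`.
-/

noncomputable section

open MeasureTheory Set Filter ENNReal

namespace Literature.NumberTheory.Transcendental

/-! ### The multiple zeta summand and summation domain under `Fin.cons` -/

/-- The summand of the empty index is the empty product `1`. [folklore] -/
theorem mzvTerm_nil (n : Fin 0 → ℕ) : mzvTerm [] n = 1 := Fin.prod_univ_zero _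

/-- Prepending the exponent `1` and the index `M`: `T_{1::s}(M :: n) = M⁻¹ · T_s(n)`. [folklore] -/
theorem mzvTerm_one_cons (s : List ℕ) (M : ℕ) (n : Fin s.length → ℕ) :
    mzvTerm (1 :: s) (Fin.cons M n) = (M : ℝ)⁻¹ * mzvTerm s n := by
  simp [mzvTerm, Fin.prod_univ_succ, mul_comm]

/-- Raising the first exponent: `T_{(a+1)::s}(n) = T_{a::s}(n) · n₁⁻¹`. [folklore] -/
theorem mzvTerm_succ_cons (a : ℕ) (s : List ℕ) (n : Fin (s.length + 1) → ℕ) :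
    mzvTerm ((a + 1) :: s) n = mzvTerm (a :: s) n * ((n 0 : ℕ) : ℝ)⁻¹ := by
  unfold mzvTerm
  simp only [List.length_cons, Fin.prod_univ_succ, Fin.getElem_fin, Fin.val_zero, Fin.val_succ,
    List.getElem_cons_zero, List.getElem_cons_succ, pow_succ, mul_inv]
  ring

/-- `M :: n` is a strictly decreasing tuple of positive integers iff `n` is, `M` exceeds all
entries of `n`, and `M > 0`. [folklore] -/
theorem cons_mem_mzvIndexSet_iff {k M : ℕ} {n : Fin k → ℕ} :
    (Fin.cons M n : Fin (k + 1) → ℕ) ∈ mzvIndexSet (k + 1) ↔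
      n ∈ mzvIndexSet k ∧ (∀ i, n i < M) ∧ 0 < M := by
  constructor
  · rintro ⟨hanti, hpos⟩
    refine ⟨⟨fun i j hij => ?_, fun i => by simpa using hpos i.succ⟩, fun i => ?_,
      by simpa using hpos 0⟩
    · simpa using hanti (Fin.succ_lt_succ_iff.2 hij)
    · simpa using hanti (Fin.succ_pos i)
  · rintro ⟨⟨hanti, hpos⟩, hlt, hM⟩
    refine ⟨KZ.MZVSimplex.strictAnti_cons hanti hlt, fun i => ?_⟩
    induction i using Fin.cases with
    | zero => simpa using hM
    | succ i => simpa using hpos i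

namespace KZ

namespace MZVSimplex

/-! ### The induction along the binary word -/

/-- **The letter `1` (new largest index).** If `Λ_ε^w(x) = ∑_{n} x^{N(n)} T(n)` over
`n ∈ mzvIndexSet k`, where prepending `M` to `n` lands in `mzvIndexSet (k+1)` exactly when
`M > N(n)`, and `T'(M :: n) = M⁻¹ T(n)`, then
`Λ_{1ε}^{w+1}(x) = ∑_{n' ∈ mzvIndexSet (k+1)} x^{n'₁} T'(n')` (`0 < x ≤ 1`).
[Zagier 1994, §9] [folklore] -/
theorem wordLIntegral_true_cons {k : ℕ} (N : (Fin k → ℕ) → ℕ)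
    (hN : ∀ (M : ℕ) (n : Fin k → ℕ), (Fin.cons M n : Fin (k + 1) → ℕ) ∈ mzvIndexSet (k + 1) ↔
      n ∈ mzvIndexSet k ∧ N n < M)
    (T : (Fin k → ℕ) → ℝ) (hT : ∀ n, 0 ≤ T n) (T' : (Fin (k + 1) → ℕ) → ℝ)
    (hT' : ∀ (M : ℕ) (n : Fin k → ℕ), T' (Fin.cons M n) = (M : ℝ)⁻¹ * T n)
    (ε : List Bool) (w : ℕ)
    (IH : ∀ x ∈ Ioc (0 : ℝ) 1,
      ∫⁻ t in {t : Fin w → ℝ | (∀ i, 0 < t i) ∧ (∀ i, t i < x) ∧ StrictAnti t},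
          ∏ i : Fin w, ENNReal.ofReal (mzvForm (ε.getD i false) (t i)) =
        ∑' n : mzvIndexSet k, ENNReal.ofReal (x ^ N n.1 * T n.1))
    {x : ℝ} (hx : x ∈ Ioc (0 : ℝ) 1) :
    ∫⁻ t in {t : Fin (w + 1) → ℝ | (∀ i, 0 < t i) ∧ (∀ i, t i < x) ∧ StrictAnti t},
        ∏ i : Fin (w + 1), ENNReal.ofReal (mzvForm ((true :: ε).getD i false) (t i)) =
      ∑' n : mzvIndexSet (k + 1), ENNReal.ofReal (x ^ (n.1 0) * T' n.1) := by
  rw [wordLIntegral_cons]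
  calc ∫⁻ t₀ in Ioo 0 x, ENNReal.ofReal (mzvForm true t₀) *
        ∫⁻ t in {t : Fin w → ℝ | (∀ i, 0 < t i) ∧ (∀ i, t i < t₀) ∧ StrictAnti t},
          ∏ i : Fin w, ENNReal.ofReal (mzvForm (ε.getD i false) (t i))
      = ∫⁻ t in Ioo 0 x, ENNReal.ofReal (1 / (1 - t)) * ∑' n : mzvIndexSet k,
          ENNReal.ofReal (T n.1) * ENNReal.ofReal (t ^ N n.1) := by
        refine setLIntegral_congr_fun measurableSet_Ioo fun t ht => ?_
        rw [IH t ⟨ht.1, (ht.2.trans_le hx.2).le⟩, mzvForm_true]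
        congr 1
        exact tsum_congr fun n => by rw [ENNReal.ofReal_mul (pow_nonneg ht.1.le _), mul_comm]
    _ = ∑' p : mzvIndexSet k × ℕ, ENNReal.ofReal (T p.1.1) *
          ENNReal.ofReal (x ^ (N p.1.1 + p.2 + 1) / (N p.1.1 + p.2 + 1 : ℕ)) :=
        lintegral_inv_one_sub_mul_tsum _ _ hx.1.le hx.2
    _ = ∑' n : mzvIndexSet (k + 1), ENNReal.ofReal (x ^ (n.1 0) * T' n.1) := by
        have hmem : ∀ n : mzvIndexSet (k + 1),
            Fin.tail n.1 ∈ mzvIndexSet k ∧ N (Fin.tail n.1) < n.1 0 := fun n =>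
          (hN (n.1 0) (Fin.tail n.1)).1 (by rw [Fin.cons_self_tail]; exact n.2)
        let e : mzvIndexSet (k + 1) ≃ mzvIndexSet k × ℕ :=
          { toFun := fun n => (⟨Fin.tail n.1, (hmem n).1⟩, n.1 0 - N (Fin.tail n.1) - 1)
            invFun := fun p =>
              ⟨Fin.cons (N p.1.1 + p.2 + 1) p.1.1, (hN _ _).2 ⟨p.1.2, by omega⟩⟩
            left_inv := fun n => by
              apply Subtype.ext
              have : N (Fin.tail n.1) + (n.1 0 - N (Fin.tail n.1) - 1) + 1 = n.1 0 := by
                have := (hmem n).2; omega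
              simp only [this, Fin.cons_self_tail]
            right_inv := fun p => by
              rcases p with ⟨⟨n, hn⟩, m⟩
              refine Prod.ext (Subtype.ext ?_) ?_
              · show Fin.tail (Fin.cons (N n + m + 1) n : Fin (k + 1) → ℕ) = n
                exact Fin.tail_cons _ _
              · show (Fin.cons (N n + m + 1) n : Fin (k + 1) → ℕ) 0 -
                    N (Fin.tail (Fin.cons (N n + m + 1) n : Fin (k + 1) → ℕ)) - 1 = m
                simp only [Fin.cons_zero, Fin.tail_cons]
                omega }
        rw [← e.symm.tsum_eq]
        refine tsum_congr fun p => ?_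
        rcases p with ⟨⟨n, hn⟩, m⟩
        show _ = ENNReal.ofReal (x ^ ((Fin.cons (N n + m + 1) n : Fin (k + 1) → ℕ) 0) *
          T' (Fin.cons (N n + m + 1) n))
        rw [Fin.cons_zero, hT', ← ENNReal.ofReal_mul (hT _)]
        congr 1
        rw [div_eq_mul_inv]
        ring

/-- **The letter `0` (raising the first exponent).** If `Λ_ε^w(x) = ∑_{n} x^{n₁} T(n)` over
`n ∈ mzvIndexSet (k+1)` and `T'(n) = T(n) · n₁⁻¹`, then `Λ_{0ε}^{w+1}(x) = ∑_{n} x^{n₁} T'(n)`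
(`0 < x ≤ 1`). [Zagier 1994, §9] [folklore] -/
theorem wordLIntegral_false_cons {k : ℕ} (T T' : (Fin (k + 1) → ℕ) → ℝ) (hT : ∀ n, 0 ≤ T n)
    (hT' : ∀ n, T' n = T n * ((n 0 : ℕ) : ℝ)⁻¹) (ε : List Bool) (w : ℕ)
    (IH : ∀ x ∈ Ioc (0 : ℝ) 1,
      ∫⁻ t in {t : Fin w → ℝ | (∀ i, 0 < t i) ∧ (∀ i, t i < x) ∧ StrictAnti t},
          ∏ i : Fin w, ENNReal.ofReal (mzvForm (ε.getD i false) (t i)) =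
        ∑' n : mzvIndexSet (k + 1), ENNReal.ofReal (x ^ (n.1 0) * T n.1))
    {x : ℝ} (hx : x ∈ Ioc (0 : ℝ) 1) :
    ∫⁻ t in {t : Fin (w + 1) → ℝ | (∀ i, 0 < t i) ∧ (∀ i, t i < x) ∧ StrictAnti t},
        ∏ i : Fin (w + 1), ENNReal.ofReal (mzvForm ((false :: ε).getD i false) (t i)) =
      ∑' n : mzvIndexSet (k + 1), ENNReal.ofReal (x ^ (n.1 0) * T' n.1) := by
  rw [wordLIntegral_cons]
  calc ∫⁻ t₀ in Ioo 0 x, ENNReal.ofReal (mzvForm false t₀) *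
        ∫⁻ t in {t : Fin w → ℝ | (∀ i, 0 < t i) ∧ (∀ i, t i < t₀) ∧ StrictAnti t},
          ∏ i : Fin w, ENNReal.ofReal (mzvForm (ε.getD i false) (t i))
      = ∫⁻ t in Ioo 0 x, ENNReal.ofReal (1 / t) * ∑' n : mzvIndexSet (k + 1),
          ENNReal.ofReal (T n.1) * ENNReal.ofReal (t ^ (n.1 0)) := by
        refine setLIntegral_congr_fun measurableSet_Ioo fun t ht => ?_
        rw [IH t ⟨ht.1, (ht.2.trans_le hx.2).le⟩, mzvForm_false]
        congr 1
        exact tsum_congr fun n => by rw [ENNReal.ofReal_mul (pow_nonneg ht.1.le _), mul_comm]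
    _ = ∑' n : mzvIndexSet (k + 1), ENNReal.ofReal (T n.1) *
          ENNReal.ofReal (x ^ (n.1 0) / (n.1 0 : ℕ)) :=
        lintegral_inv_mul_tsum _ (fun n : mzvIndexSet (k + 1) => n.1 0) (fun n => n.2.2 0)
          hx.1.le
    _ = ∑' n : mzvIndexSet (k + 1), ENNReal.ofReal (x ^ (n.1 0) * T' n.1) := by
        refine tsum_congr fun n => ?_
        rw [hT', ← ENNReal.ofReal_mul (hT _)]
        congr 1
        rw [div_eq_mul_inv]
        ring

/-- The weight of `a :: s` splits off the first entry. [folklore] -/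
theorem weight_cons (a : ℕ) (s : List ℕ) : MZV.weight (a :: s) = a + MZV.weight s := by
  simp [MZV.weight]

/-- Inner induction on the first exponent: from the word of `1 :: s` to that of `(b+1) :: s` by
`b` letters `0`. [Zagier 1994, §9] [folklore] -/
theorem wordLIntegral_binaryWord_succ_cons (s : List ℕ)
    (h1 : ∀ x ∈ Ioc (0 : ℝ) 1,
      ∫⁻ t in {t : Fin (MZV.weight (1 :: s)) → ℝ | (∀ i, 0 < t i) ∧ (∀ i, t i < x) ∧ StrictAnti t},
          ∏ i : Fin (MZV.weight (1 :: s)),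
            ENNReal.ofReal (mzvForm ((MZV.binaryWord (1 :: s)).getD i false) (t i)) =
        ∑' n : mzvIndexSet (s.length + 1), ENNReal.ofReal (x ^ (n.1 0) * mzvTerm (1 :: s) n.1)) :
    ∀ (b : ℕ), ∀ x ∈ Ioc (0 : ℝ) 1,
      ∫⁻ t in {t : Fin (MZV.weight ((b + 1) :: s)) → ℝ |
          (∀ i, 0 < t i) ∧ (∀ i, t i < x) ∧ StrictAnti t},
          ∏ i : Fin (MZV.weight ((b + 1) :: s)),
            ENNReal.ofReal (mzvForm ((MZV.binaryWord ((b + 1) :: s)).getD i false) (t i)) =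
        ∑' n : mzvIndexSet (s.length + 1),
          ENNReal.ofReal (x ^ (n.1 0) * mzvTerm ((b + 1) :: s) n.1)
  | 0 => h1
  | b + 1 => by
    intro x hx
    have hw : MZV.weight ((b + 1 + 1) :: s) = MZV.weight ((b + 1) :: s) + 1 := by
      simp only [weight_cons]; omega
    have hb : MZV.binaryWord ((b + 1 + 1) :: s) = false :: MZV.binaryWord ((b + 1) :: s) := rfl
    rw [hb, hw]
    exact wordLIntegral_false_cons (mzvTerm ((b + 1) :: s)) (mzvTerm ((b + 1 + 1) :: s))
      (mzvTerm_nonneg ((b + 1) :: s)) (mzvTerm_succ_cons (b + 1) s) _ _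
      (wordLIntegral_binaryWord_succ_cons s h1 b) hx

/-- **The iterated integral is the multiple polylogarithm**: for a nonempty index `a :: s` with
positive entries and `0 < x ≤ 1`,
`Λ_{ε(a::s)}(x) = ∑_{n₁ > ⋯ > n_k ≥ 1} x^{n₁} n₁^{-a} n₂^{-s₂} ⋯` (in `ℝ≥0∞`, both sides possibly
`∞` when `a = 1`, `x = 1`). [Zagier 1994, §9; Kontsevich–Zagier 2001, §1.1] [folklore] -/
theorem wordLIntegral_binaryWord : ∀ (s : List ℕ) (a : ℕ), (∀ i ∈ a :: s, 1 ≤ i) →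
    ∀ x ∈ Ioc (0 : ℝ) 1,
      ∫⁻ t in {t : Fin (MZV.weight (a :: s)) → ℝ | (∀ i, 0 < t i) ∧ (∀ i, t i < x) ∧ StrictAnti t},
          ∏ i : Fin (MZV.weight (a :: s)),
            ENNReal.ofReal (mzvForm ((MZV.binaryWord (a :: s)).getD i false) (t i)) =
        ∑' n : mzvIndexSet (s.length + 1),
          ENNReal.ofReal (x ^ (n.1 0) * mzvTerm (a :: s) n.1) := by
  intro s
  induction s with
  | nil =>
    intro a ha
    obtain ⟨b, rfl⟩ : ∃ b, a = b + 1 := Nat.exists_eq_add_of_le' (ha a (by simp))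
    refine wordLIntegral_binaryWord_succ_cons [] (fun x hx => ?_) b
    -- the word `1`: `Λ_1(x) = ∑_{M ≥ 1} x^M / M`, from `Λ_∅ = 1`
    have hmem : (fun i => i.elim0 : Fin 0 → ℕ) ∈ mzvIndexSet 0 :=
      ⟨fun i => i.elim0, fun i => i.elim0⟩
    have IH0 : ∀ y ∈ Ioc (0 : ℝ) 1,
        ∫⁻ t in {t : Fin 0 → ℝ | (∀ i, 0 < t i) ∧ (∀ i, t i < y) ∧ StrictAnti t},
            ∏ i : Fin 0, ENNReal.ofReal (mzvForm (([] : List Bool).getD i false) (t i)) =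
          ∑' n : mzvIndexSet 0, ENNReal.ofReal (y ^ (fun _ => 0 : (Fin 0 → ℕ) → ℕ) n.1 *
            mzvTerm [] n.1) := by
      intro y hy
      rw [wordLIntegral_zero]
      refine ((tsum_eq_single ⟨_, hmem⟩ fun n hn =>
        absurd (Subtype.ext (funext fun i => i.elim0)) hn).trans ?_).symm
      rw [mzvTerm_nil, pow_zero, one_mul, ENNReal.ofReal_one]
    have hN : ∀ (M : ℕ) (n : Fin 0 → ℕ), (Fin.cons M n : Fin 1 → ℕ) ∈ mzvIndexSet 1 ↔
        n ∈ mzvIndexSet 0 ∧ (fun _ => 0 : (Fin 0 → ℕ) → ℕ) n < M := fun M n => by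
      rw [cons_mem_mzvIndexSet_iff]
      simp only [IsEmpty.forall_iff, true_and]
    exact wordLIntegral_true_cons (fun _ => 0) hN (mzvTerm []) (mzvTerm_nonneg [])
      (mzvTerm [1]) (mzvTerm_one_cons []) [] 0 IH0 hx
  | cons a' s ih =>
    intro a ha
    obtain ⟨b, rfl⟩ : ∃ b, a = b + 1 := Nat.exists_eq_add_of_le' (ha _ (by simp))
    refine wordLIntegral_binaryWord_succ_cons (a' :: s) (fun x hx => ?_) b
    have IH := ih a' fun i hi => ha i (List.mem_cons_of_mem _ hi)
    have hN : ∀ (M : ℕ) (n : Fin (s.length + 1) → ℕ),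
        (Fin.cons M n : Fin (s.length + 2) → ℕ) ∈ mzvIndexSet (s.length + 2) ↔
          n ∈ mzvIndexSet (s.length + 1) ∧ n 0 < M := fun M n => by
      rw [cons_mem_mzvIndexSet_iff]
      constructor
      · rintro ⟨hn, hlt, -⟩
        exact ⟨hn, hlt 0⟩
      · rintro ⟨hn, h0⟩
        exact ⟨hn, fun i => (hn.1.antitone (Fin.zero_le i)).trans_lt h0, (hn.2 0).trans h0⟩
    have hw : MZV.weight (1 :: a' :: s) = MZV.weight (a' :: s) + 1 := by
      rw [weight_cons]; omega
    rw [hw]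
    exact wordLIntegral_true_cons (fun n => n 0) hN (mzvTerm (a' :: s))
      (mzvTerm_nonneg (a' :: s)) (mzvTerm (1 :: a' :: s)) (mzvTerm_one_cons (a' :: s)) _ _ IH hx

end MZVSimplex

/-! ### Kontsevich's formula -/

/-- **Kontsevich's formula** [Kontsevich–Zagier 2001, §1.1 (example of multiple zeta values);
Zagier 1994, §9; Brown 2012, eq. (1.2)]: the value of the simplex representation `KZ.mzvRep s`
is the multiple zeta value, `∫_{1 > t₁ > ⋯ > t_w > 0} ∏ᵢ ω_{εᵢ}(tᵢ) dt = ζ(s₁, …, s_k)`, for every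
admissible index `s`. Discharges the named fact `KZ.mzvRep_value`.
[cite: KontsevichZagier2001, §1.1] -/
theorem mzvRep_value_holds : mzvRep_value := by
  intro s hs h₁ h₂
  rw [mzvRep_value_eq]
  have hS : MeasurableSet (openOrderedSimplex (MZV.weight s)) :=
    MZVSimplex.measurableSet_simplexLT _ 1
  have hnn : ∀ t ∈ openOrderedSimplex (MZV.weight s), ∀ (i : Fin (MZV.weight s)) (e : Bool),
      0 ≤ mzvForm e (t i) := fun t ht i e => by
    cases e
    · exact (one_div_pos.2 (ht.1 i)).le
    · exact (one_div_pos.2 (sub_pos.2 (ht.2.1 i))).le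
  have hae : 0 ≤ᵐ[volume.restrict (openOrderedSimplex (MZV.weight s))] mzvIntegrand s :=
    (ae_restrict_iff' hS).2 (ae_of_all _ fun t ht => Finset.prod_nonneg fun i _ => hnn t ht i _)
  have hΛ : ∫⁻ t in openOrderedSimplex (MZV.weight s), ENNReal.ofReal (mzvIntegrand s t) =
      ∫⁻ t in {t : Fin (MZV.weight s) → ℝ | (∀ i, 0 < t i) ∧ (∀ i, t i < 1) ∧ StrictAnti t},
        ∏ i : Fin (MZV.weight s), ENNReal.ofReal (mzvForm ((MZV.binaryWord s).getD i false) (t i)) :=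
    setLIntegral_congr_fun hS fun t ht => ENNReal.ofReal_prod_of_nonneg fun i _ => hnn t ht i _
  rw [integral_eq_lintegral_of_nonneg_ae hae h₂.aestronglyMeasurable, hΛ]
  cases s with
  | nil => rw [multipleZeta_nil, MZV.weight_nil, MZVSimplex.wordLIntegral_zero, ENNReal.toReal_one]
  | cons a s =>
    rw [MZVSimplex.wordLIntegral_binaryWord s a hs.1 1 ⟨one_pos, le_rfl⟩,
      ENNReal.tsum_toReal_eq fun _ => ENNReal.ofReal_ne_top]
    exact tsum_congr fun n => by rw [one_pow, one_mul, ENNReal.toReal_ofReal (mzvTerm_nonneg _ _)]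

end KZ

end Literature.NumberTheory.Transcendental
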